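import Mathlib.LinearAlgebra.Matrix.NonsingularInverse
import Literature.MathematicalPhysics.QuantumLattice.TransferOperatorDual
import HarnessLib

/-!
# Gauge and scale transformations of an MPS tensor; the normalised (canonical) gauge

Sibling proof file of `Literature/MathematicalPhysics/QuantumLattice/MatrixProductStates.lean`
(theorem-only: no definition, no named fact), a step towards the discharge of
`fannes_nachtergaele_werner_gap` (`LiebRobinson.lean`; Fannes–Nachtergaele–Werner 1992, Thm. 6.4).
It reduces statements about the parent Hamiltonian of a normal tensor to the *normalised* gauge
`Σ_i A^{i} A^{i}† = 𝟙`, `Σ_i A^{i}† ρ A^{i} = ρ` (`ρ > 0`, `tr ρ = 1`) assumed throughout FNW §5–§6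
(eq. (5.3)) and in Perez-Garcia–Verstraete–Wolf–Cirac (2007) (canonical form, Thm. 4):

* `wordProduct_gauge`, `mpsWithBoundary_gauge` — `A' = c Y⁻¹ A Y` has `A'^{w} = c^{|w|} Y⁻¹ A^{w} Y`
  and `ψ'_B = c^{n} ψ_{Y B Y⁻¹}`;
* `mpsRange_gauge`, `parentHamiltonian_gauge`, `IsInjectiveMPS.gauge` — the spaces `𝒢_n`, the
  parent Hamiltonian and injectivity are unchanged (`c ≠ 0`, `Y` invertible);
* `transferOp_gauge`, `transferOp_conjTranspose_gauge` — the transfer operator and its dual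
  transform by conjugation and the factor `|c|²`;
* `exists_normalised_gauge` — **existence of the normalised gauge** for a tensor injective at a
  positive length (`D > 0`): from the Perron–Frobenius data `𝔼(X₀) = r X₀`, `𝔼†(ρ₀) = r ρ₀`
  (`IsInjectiveMPS.exists_posDef_eigenvector`, `…_left_eigenvector` of
  `TransferOperatorPerron/Dual.lean`), factor `X₀ = Y Yᴴ`
  (`CStarAlgebra.isStrictlyPositive_iff_eq_star_mul_self`) and take `c = r^{-1/2}`,
  `ρ ∝ Yᴴ ρ₀ Y`.

## Sources

* M. Fannes, B. Nachtergaele, R. F. Werner, Comm. Math. Phys. **144** (1992) 443–490, §2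
  (Lemma 2.5: `𝔼(𝟙) = 𝟙` may be assumed), §5 eq. (5.3) (`Σ v(μ) v(μ)^* = 𝟙`, `Σ v(μ)^* ρ v(μ) = ρ`).
  [FannesNachtergaeleWernerCMP1992]
* D. Perez-Garcia, F. Verstraete, M. M. Wolf, J. I. Cirac, Quantum Inf. Comput. **7** (2007)
  401–430, §2.1 Thm. 4 (canonical form: `Σ_i A_i A_i† = 𝟙`, `Σ_i A_i† Λ A_i = Λ`, `Λ` positive,
  full rank for a normal tensor), Thm. 7 (gauge freedom), §4 (the parent Hamiltonian depends only on
  the spaces `𝒢_L`). [PerezGarciaVerstraeteWolfCiracQIC2007]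
-/

noncomputable section

open Matrix
open scoped ComplexOrder MatrixOrder

namespace Literature.MathematicalPhysics.QuantumLattice

section QLattice

variable {q D : ℕ}

/-! ### Word products, boundary MPS, MPS spaces and injectivity under `A ↦ c Y⁻¹ A Y` -/

/-- **Word products transform by conjugation and scaling**: for the gauged and scaled tensor
`A'^{i} = c Y⁻¹ A^{i} Y` (with `Y` invertible), `A'^{w} = c^{|w|} Y⁻¹ A^{w} Y`.
Perez-Garcia–Verstraete–Wolf–Cirac (2007) §2.1 / Thm. 7 (gauge freedom of MPS). [folklore] -/
theorem wordProduct_gauge (A : MPSTensor q D) (c : ℂ) {Y : Matrix (Fin D) (Fin D) ℂ}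
    (hY : IsUnit Y.det) {n : ℕ} (w : Fin n → Fin q) :
    wordProduct (fun i => c • (Y⁻¹ * A i * Y)) w = c ^ n • (Y⁻¹ * wordProduct A w * Y) := by
  induction n with
  | zero => simp [wordProduct, nonsing_inv_mul Y hY]
  | succ n ih =>
    rw [← Fin.cons_self_tail w, wordProduct_cons, wordProduct_cons, ih, smul_mul_smul_comm,
      pow_succ']
    congr 1
    simp only [Matrix.mul_assoc]
    rw [← Matrix.mul_assoc Y Y⁻¹, mul_nonsing_inv Y hY, Matrix.one_mul]

/-- **Boundary MPS under gauge and scaling**: `ψ'_B = c^{n} ψ_{Y B Y⁻¹}` (cyclicity of the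
trace). Perez-Garcia–Verstraete–Wolf–Cirac (2007) §2.1. [folklore] -/
theorem mpsWithBoundary_gauge (A : MPSTensor q D) (c : ℂ) {Y : Matrix (Fin D) (Fin D) ℂ}
    (hY : IsUnit Y.det) (n : ℕ) (B : Matrix (Fin D) (Fin D) ℂ) :
    mpsWithBoundary n (fun i => c • (Y⁻¹ * A i * Y)) B =
      c ^ n • mpsWithBoundary n A (Y * B * Y⁻¹) := by
  funext σ
  simp only [mpsWithBoundary, Pi.smul_apply, smul_eq_mul, wordProduct_gauge A c hY,
    Matrix.mul_smul, trace_smul]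
  congr 1
  rw [← Matrix.mul_assoc, ← Matrix.mul_assoc, trace_mul_cycle, ← Matrix.mul_assoc]

/-- **The MPS spaces `𝒢_n` are gauge invariant** (`c ≠ 0`, `Y` invertible): every `ψ'_B` is a
multiple of a `ψ_{B'}` and conversely. Perez-Garcia–Verstraete–Wolf–Cirac (2007) §2.1, §4
(the parent Hamiltonian depends on the state only). [folklore] -/
theorem mpsRange_gauge (A : MPSTensor q D) {c : ℂ} (hc : c ≠ 0) {Y : Matrix (Fin D) (Fin D) ℂ}
    (hY : IsUnit Y.det) (n : ℕ) :
    mpsRange n (fun i => c • (Y⁻¹ * A i * Y)) = mpsRange n A := by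
  apply le_antisymm
  · refine Submodule.span_le.2 ?_
    rintro _ ⟨B, rfl⟩
    dsimp only
    rw [mpsWithBoundary_gauge A c hY, WithLp.toLp_smul]
    exact Submodule.smul_mem _ _ (Submodule.subset_span ⟨Y * B * Y⁻¹, rfl⟩)
  · refine Submodule.span_le.2 ?_
    rintro _ ⟨B, rfl⟩
    have h : mpsWithBoundary n A B =
        (c ^ n)⁻¹ • mpsWithBoundary n (fun i => c • (Y⁻¹ * A i * Y)) (Y⁻¹ * B * Y) := by
      rw [mpsWithBoundary_gauge A c hY, smul_smul, inv_mul_cancel₀ (pow_ne_zero n hc), one_smul,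
        ← Matrix.mul_assoc, ← Matrix.mul_assoc, mul_nonsing_inv Y hY, Matrix.one_mul,
        Matrix.mul_assoc, mul_nonsing_inv Y hY, Matrix.mul_one]
    dsimp only
    rw [h, WithLp.toLp_smul]
    exact Submodule.smul_mem _ _ (Submodule.subset_span ⟨Y⁻¹ * B * Y, rfl⟩)

/-- **The parent Hamiltonian is gauge invariant**: it depends on the tensor only through the MPS
spaces `𝒢_ℓ`. Perez-Garcia–Verstraete–Wolf–Cirac (2007) §4. [folklore] -/
theorem parentHamiltonian_gauge (A : MPSTensor q D) {c : ℂ} (hc : c ≠ 0)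
    {Y : Matrix (Fin D) (Fin D) ℂ} (hY : IsUnit Y.det) (L : ℕ) [NeZero L] (ℓ : ℕ) :
    parentHamiltonian L ℓ (fun i => c • (Y⁻¹ * A i * Y)) = parentHamiltonian L ℓ A := by
  simp only [parentHamiltonian, parentLocalTerm, mpsRange_gauge A hc hY]

/-- **Injectivity is gauge invariant**: if the words of length `n` of `A` span `M_D(ℂ)`, so do
those of `c Y⁻¹ A Y` (`c ≠ 0`, `Y` invertible): `M = Y⁻¹ (Y M Y⁻¹) Y` and `Y M Y⁻¹` is a
combination of words. Perez-Garcia–Verstraete–Wolf–Cirac (2007) §3.2. [folklore] -/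
theorem IsInjectiveMPS.gauge {A : MPSTensor q D} {n : ℕ} (h : IsInjectiveMPS A n) {c : ℂ}
    (hc : c ≠ 0) {Y : Matrix (Fin D) (Fin D) ℂ} (hY : IsUnit Y.det) :
    IsInjectiveMPS (fun i => c • (Y⁻¹ * A i * Y)) n := by
  unfold IsInjectiveMPS at h ⊢
  have key : ∀ M ∈ Submodule.span ℂ (Set.range (wordProduct (ℓ := n) A)),
      Y⁻¹ * M * Y ∈ Submodule.span ℂ
        (Set.range (wordProduct (ℓ := n) fun i => c • (Y⁻¹ * A i * Y))) := by
    intro M hM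
    induction hM using Submodule.span_induction with
    | mem x hx =>
      obtain ⟨w, rfl⟩ := hx
      have e : Y⁻¹ * wordProduct A w * Y =
          (c ^ n)⁻¹ • wordProduct (fun i => c • (Y⁻¹ * A i * Y)) w := by
        rw [wordProduct_gauge A c hY, smul_smul, inv_mul_cancel₀ (pow_ne_zero n hc), one_smul]
      rw [e]
      exact Submodule.smul_mem _ _ (Submodule.subset_span ⟨w, rfl⟩)
    | zero => simp
    | add x y _ _ hx hy =>
      rw [Matrix.mul_add, Matrix.add_mul]
      exact add_mem hx hy
    | smul a x _ hx =>
      rw [Matrix.mul_smul, Matrix.smul_mul]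
      exact Submodule.smul_mem _ _ hx
  rw [eq_top_iff]
  intro M _
  have hM : Y * M * Y⁻¹ ∈ Submodule.span ℂ (Set.range (wordProduct (ℓ := n) A)) := by
    rw [h]; exact Submodule.mem_top
  have h2 := key _ hM
  rwa [← Matrix.mul_assoc, ← Matrix.mul_assoc, nonsing_inv_mul Y hY, Matrix.one_mul,
    Matrix.mul_assoc, nonsing_inv_mul Y hY, Matrix.mul_one] at h2

/-! ### The transfer operator under gauge and scaling -/

/-- `𝔼'(X) = |c|² Y⁻¹ 𝔼(Y X Yᴴ) Y⁻¹ᴴ` for `A' = c Y⁻¹ A Y`. [folklore] -/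
theorem transferOp_gauge (A : MPSTensor q D) (c : ℂ) (Y X : Matrix (Fin D) (Fin D) ℂ) :
    transferOp (fun i => c • (Y⁻¹ * A i * Y)) X =
      (c * star c) • (Y⁻¹ * transferOp A (Y * X * Yᴴ) * Y⁻¹ᴴ) := by
  simp only [transferOp_apply, conjTranspose_smul, conjTranspose_mul, Matrix.smul_mul,
    Matrix.mul_smul, smul_smul, Finset.mul_sum, Finset.sum_mul, Finset.smul_sum]
  refine Finset.sum_congr rfl fun i _ => ?_
  rw [mul_comm (star c) c]
  simp only [Matrix.mul_assoc]

/-- `𝔼'†(Z) = |c|² Yᴴ 𝔼†(Y⁻¹ᴴ Z Y⁻¹) Y` for `A' = c Y⁻¹ A Y`. [folklore] -/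
theorem transferOp_conjTranspose_gauge (A : MPSTensor q D) (c : ℂ)
    (Y Z : Matrix (Fin D) (Fin D) ℂ) :
    transferOp (fun i => (c • (Y⁻¹ * A i * Y))ᴴ) Z =
      (c * star c) • (Yᴴ * transferOp (fun i => (A i)ᴴ) (Y⁻¹ᴴ * Z * Y⁻¹) * Y) := by
  simp only [transferOp_apply, conjTranspose_smul, conjTranspose_mul, conjTranspose_conjTranspose,
    star_star, Matrix.smul_mul, Matrix.mul_smul, smul_smul, Finset.mul_sum, Finset.sum_mul,
    Finset.smul_sum]
  refine Finset.sum_congr rfl fun i _ => ?_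
  simp only [Matrix.mul_assoc]

/-! ### The normalised gauge -/

/-- **The normalised (canonical) gauge of a normal tensor** (Fannes–Nachtergaele–Werner 1992
§2, Lemma 2.5 / (5.3): `𝔼(𝟙) = 𝟙`, `ρ ∘ 𝔼 = ρ` with `ρ` faithful; Perez-Garcia–Verstraete–Wolf–Cirac
2007 §2.1 Thm. 4 / §3.2: canonical form with `Σ_i A_i A_i† = 𝟙`, `Σ_i A_i† Λ A_i = Λ > 0`). If the
words of a positive length `m` of `A` span `M_D(ℂ)` (`D > 0`), there are a gauge-and-scale
transform `A'^{i} = c Y⁻¹ A^{i} Y` (`c ≠ 0`, `Y` invertible) and a density matrix `ρ > 0`,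
`tr ρ = 1`, with `Σ_i A'^{i} A'^{i}† = 𝟙` (`𝔼'(𝟙) = 𝟙`) and `Σ_i A'^{i}† ρ A'^{i} = ρ`
(`𝔼'†(ρ) = ρ`). Construction: with the Perron–Frobenius data `𝔼(X₀) = r X₀`, `𝔼†(ρ₀) = r ρ₀`
(`X₀, ρ₀ > 0`, `r > 0`; `TransferOperatorPerron/Dual`), factor `X₀ = Y Yᴴ` and put `c = r^{-1/2}`,
`ρ ∝ Yᴴ ρ₀ Y`. The parent Hamiltonian, the spaces `𝒢_n` and injectivity are unchanged
(`parentHamiltonian_gauge`, `mpsRange_gauge`, `IsInjectiveMPS.gauge`).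
[cite: PerezGarciaVerstraeteWolfCiracQIC2007, §2.1 Thm. 4] -/
theorem exists_normalised_gauge [NeZero D] {A : MPSTensor q D} {m : ℕ} (hA : IsInjectiveMPS A m)
    (hm : 0 < m) :
    ∃ (c : ℂ) (Y ρ : Matrix (Fin D) (Fin D) ℂ), c ≠ 0 ∧ IsUnit Y.det ∧ ρ.PosDef ∧ ρ.trace = 1 ∧
      transferOp (fun i => c • (Y⁻¹ * A i * Y)) 1 = 1 ∧
      transferOp (fun i => (c • (Y⁻¹ * A i * Y))ᴴ) ρ = ρ := by
  -- Perron–Frobenius data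
  obtain ⟨r, hr, X₀, hX₀, hTX₀⟩ := hA.exists_posDef_eigenvector hm
  obtain ⟨ρ₀, hρ₀, hTρ₀⟩ := hA.exists_posDef_left_eigenvector hm hX₀ hTX₀
  -- factor `X₀ = Y Yᴴ` with `Y` invertible
  obtain ⟨b, hb, hX₀b⟩ :=
    CStarAlgebra.isStrictlyPositive_iff_eq_star_mul_self.mp hX₀.isStrictlyPositive
  set Y : Matrix (Fin D) (Fin D) ℂ := bᴴ with hYdef
  have hYb : X₀ = Y * Yᴴ := by rw [hX₀b, hYdef, conjTranspose_conjTranspose]; rfl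
  have hY : IsUnit Y.det := by
    rw [hYdef, det_conjTranspose, isUnit_star, ← isUnit_iff_isUnit_det]
    exact hb
  have hYH : IsUnit Yᴴ.det := by
    rw [det_conjTranspose, isUnit_star]; exact hY
  -- the scale `c = r^{-1/2}`
  set c : ℂ := (((Real.sqrt r)⁻¹ : ℝ) : ℂ) with hcdef
  have hsqrt : 0 < Real.sqrt r := Real.sqrt_pos.2 hr
  have hc0 : c ≠ 0 := by
    rw [hcdef, Ne, Complex.ofReal_eq_zero]
    exact inv_ne_zero hsqrt.ne'
  have hcc : c * star c = ((r⁻¹ : ℝ) : ℂ) := by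
    rw [hcdef, Complex.star_def, Complex.conj_ofReal, ← Complex.ofReal_mul, ← mul_inv,
      Real.mul_self_sqrt hr.le]
  -- the density matrix
  set ρ₁ : Matrix (Fin D) (Fin D) ℂ := Yᴴ * ρ₀ * Y with hρ₁def
  have hρ₁ : ρ₁.PosDef := by
    rw [hρ₁def, ← star_eq_conjTranspose]
    exact (Matrix.IsUnit.posDef_star_left_conjugate_iff ((isUnit_iff_isUnit_det Y).2 hY)).2 hρ₀
  have htpos : 0 < ρ₁.trace.re := (Complex.pos_iff.1 hρ₁.trace_pos).1
  have htr : ρ₁.trace = ((ρ₁.trace.re : ℝ) : ℂ) :=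
    Complex.ext (by simp) (by simpa using (Complex.pos_iff.1 hρ₁.trace_pos).2.symm)
  set t : ℝ := ρ₁.trace.re with ht
  set ρ : Matrix (Fin D) (Fin D) ℂ := ((t⁻¹ : ℝ) : ℂ) • ρ₁ with hρdef
  refine ⟨c, Y, ρ, hc0, hY, ?_, ?_, ?_, ?_⟩
  · -- `ρ > 0`
    have e : ρ = (t⁻¹ : ℝ) • ρ₁ := by rw [hρdef, Complex.coe_smul]
    rw [e]
    exact hρ₁.smul (inv_pos.2 htpos)
  · -- `tr ρ = 1`
    rw [hρdef, trace_smul, htr, smul_eq_mul, ← Complex.ofReal_mul, inv_mul_cancel₀ htpos.ne',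
      Complex.ofReal_one]
  · -- `𝔼'(𝟙) = 𝟙`
    rw [transferOp_gauge, Matrix.mul_one, ← hYb, hTX₀, Matrix.mul_smul, Matrix.smul_mul, hYb,
      ← Matrix.mul_assoc, nonsing_inv_mul Y hY, Matrix.one_mul, conjTranspose_nonsing_inv,
      mul_nonsing_inv Yᴴ hYH, smul_smul, hcc, ← Complex.ofReal_mul, inv_mul_cancel₀ hr.ne',
      Complex.ofReal_one, one_smul]
  · -- `𝔼'†(ρ) = ρ`
    rw [transferOp_conjTranspose_gauge, hρdef, hρ₁def]
    rw [show Y⁻¹ᴴ * ((((t⁻¹ : ℝ) : ℂ)) • (Yᴴ * ρ₀ * Y)) * Y⁻¹ = (((t⁻¹ : ℝ) : ℂ)) • ρ₀ by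
      rw [Matrix.mul_smul, Matrix.smul_mul, conjTranspose_nonsing_inv, ← Matrix.mul_assoc,
        ← Matrix.mul_assoc, nonsing_inv_mul Yᴴ hYH, Matrix.one_mul, Matrix.mul_assoc,
        mul_nonsing_inv Y hY, Matrix.mul_one]]
    rw [LinearMap.map_smul, hTρ₀, smul_smul, Matrix.mul_smul, Matrix.smul_mul, smul_smul, hcc,
      ← Complex.ofReal_mul, ← Complex.ofReal_mul]
    congr 1
    rw [mul_comm (t⁻¹) r, ← mul_assoc, inv_mul_cancel₀ hr.ne', one_mul]

end QLattice

end Literature.MathematicalPhysics.QuantumLattice
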